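import Summits.Ventures.YMGap.RobustBall.EnergyVarianceBessel
import Summits.Ventures.YMGap.RobustBall.PlaquettePositivityOneLink
import HarnessLib

/-!
# Robust ball (Y2), strong-coupling laws — the inverse Efron–Stein inequality for DLR STATES on `ℤ^d`, I: the one-link kernels

HONEST FRAMING: venture file of the cell `pub-ymgap` (QuantumFields programme), track ROBUST-BALL, seat rb-p2 (g8).  LATTICE statements about
the Wilson specification `ymSpecification ρ β` on `ℤ^d` (every real `β`, compact `G`, continuous unitary `ρ`) and its DLR states; the
infinite-volume twin of `EnergyVarianceGibbsFloor` / `EnergyVarianceTorus`.  Nothing about the continuum, a spectral gap or Clay.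

CONTENT.  (A) Two abstract lemmas on the `resample` interface of `T4DobrushinTensorisation` for a law `Q` resampling-invariant under local
Markov kernels `qᵢ` which DOMINATE `e^{−δ}` times a-priori probability laws `πᵢ` on non-negative observables:
`dirichlet_ge_exp_neg_mul_fibreVariance_of_floor` (`∫ f (f − Πᵢ f) dQ ≥ e^{−δ} ∫ Var_{πᵢ}(y ↦ f(ξ^{i←y})) dQ`) and
`exp_neg_mul_integral_resample_le_of_floor`.  (B) The one-link laws of the Wilson specification as Markov kernels
`U ↦ siteLaw (ymSpecification ρ β) e U` (`measurable_siteLaw_ymSpecification`): they do not read the link they resample, nor any link on no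
common plaquette (`siteLaw_ymSpecification_update_of_separated`, finite range), every DLR state is resampling-invariant for them
(`resamplingInvariant_of_mem_ymGibbsMeasures`, the DLR equation at one link), and they dominate `e^{−4(d−1)N|β|}·Haar` on non-negative observables
(`exp_neg_mul_integral_haar_le_integral_siteLaw`, one-link oscillation of the Wilson energy).  Part II (`EnergyVarianceDLR.lean`) assembles the
extensive energy-variance floor for every DLR state.

References: H.-O. Georgii, *Gibbs Measures and Phase Transitions* (2011), Remark 1.24; H. Föllmer, LNM 1362 (1988), Ch. I §2.1; E. Seiler,
LNP 159 (1982), Ch. 2.  Everything here is proved. [folklore]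
-/

noncomputable section

open MeasureTheory ProbabilityTheory Finset Function
open Literature.MathematicalPhysics.QuantumFieldTheory.Balaban1983to89.T4DobrushinTensorisation
open Literature.MathematicalPhysics.QuantumFieldTheory.Balaban1983to89.T4CouplingChain (integrable_of_abs_le_const)
open Literature.Probability.LatticeModels Literature.Probability.LatticeModels.DobrushinMetric
open Literature.MathematicalPhysics.QuantumLattice Literature.MathematicalPhysics.QuantumFieldTheory

namespace Summit.Ventures.YMGap.RobustBall

namespace EnergyVariance

universe u v

/-! ### Part A — abstract: Dirichlet form and resampling under a density floor -/

section Abstract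

variable {ι : Type u} [DecidableEq ι] {E : ι → Type v} [∀ i, MeasurableSpace (E i)]
variable {q : (i : ι) → Kernel ((j : ι) → E j) (E i)} [∀ i, IsMarkovKernel (q i)]
variable {Q : Measure ((j : ι) → E j)} [IsProbabilityMeasure Q]

/-- **The one-site Dirichlet form dominates `e^{−δ}` times the mean a-priori fibre variance**, for local Markov kernels `qᵢ`,
a resampling-invariant law `Q`, and an a-priori probability law `π` on the `i`-th factor such that `qᵢ(ξ) ≥ e^{−δ} π` on non-negative
bounded measurable observables. [folklore] -/
theorem dirichlet_ge_exp_neg_mul_fibreVariance_of_floor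
    (hloc : ∀ (i : ι) (ξ : (j : ι) → E j) (y : E i), q i (update ξ i y) = q i ξ)
    (hinv : ResamplingInvariant Q q) (i : ι) (π : Measure (E i)) [IsProbabilityMeasure π] {δ : ℝ}
    (hfloor : ∀ (ξ : (j : ι) → E j) (g : E i → ℝ) (B : ℝ), Measurable g → (∀ y, 0 ≤ g y) → (∀ y, |g y| ≤ B) →
      Real.exp (-δ) * ∫ y, g y ∂π ≤ ∫ y, g y ∂(q i ξ))
    {f : ((j : ι) → E j) → ℝ} {B : ℝ} (hfm : Measurable f) (hB : ∀ ξ, |f ξ| ≤ B) :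
    Real.exp (-δ) * ∫ ξ, (∫ y, (f (update ξ i y) - ∫ z, f (update ξ i z) ∂π) ^ 2 ∂π) ∂Q ≤
      ∫ ξ, f ξ * (f ξ - resample q i f ξ) ∂Q := by
  rw [← integral_fluct_sq_eq hloc hinv i hfm hB]
  have hXm : Measurable fun ξ => (f ξ - resample q i f ξ) ^ 2 := (hfm.sub (measurable_resample i hfm)).pow_const 2
  have hXb : ∀ ξ, |(f ξ - resample q i f ξ) ^ 2| ≤ (B + B) ^ 2 := fun ξ => by
    rw [abs_pow]
    exact pow_le_pow_left₀ (abs_nonneg _) ((abs_sub _ _).trans (add_le_add (hB ξ) (abs_resample_le i hB ξ))) 2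
  rw [← hinv i (fun ξ => (f ξ - resample q i f ξ) ^ 2) ((B + B) ^ 2) hXm hXb]
  simp only [resample_update hloc]
  rw [← integral_const_mul]
  refine integral_mono_of_nonneg (Filter.Eventually.of_forall fun ξ => ?_) ?_ (Filter.Eventually.of_forall fun ξ => ?_)
  · exact mul_nonneg (Real.exp_pos _).le (integral_nonneg fun y => sq_nonneg _)
  · have hm : Measurable fun ξ : (j : ι) → E j => ∫ y, (f (update ξ i y) - resample q i f ξ) ^ 2 ∂(q i ξ) := by
      have h : StronglyMeasurable (fun p : ((j : ι) → E j) × E i => (f (update p.1 i p.2) - resample q i f p.1) ^ 2) :=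
        (((hfm.comp measurable_update').sub ((measurable_resample i hfm).comp measurable_fst)).pow_const 2).stronglyMeasurable
      exact (h.integral_kernel_prod_right' (κ := q i)).measurable
    refine integrable_of_abs_le_const hm.stronglyMeasurable (R := (B + B) ^ 2) fun ξ => ?_
    exact abs_integral_le_of_abs_le (q i ξ) fun y => by
      rw [abs_pow]
      exact pow_le_pow_left₀ (abs_nonneg _) ((abs_sub _ _).trans (add_le_add (hB _) (abs_resample_le i hB ξ))) 2
  · have hgm : Measurable fun y : E i => (f (update ξ i y) - resample q i f ξ) ^ 2 :=
      ((hfm.comp (measurable_update ξ)).sub measurable_const).pow_const 2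
    have hgb : ∀ y : E i, |(f (update ξ i y) - resample q i f ξ) ^ 2| ≤ (B + B) ^ 2 := fun y => by
      rw [abs_pow]
      exact pow_le_pow_left₀ (abs_nonneg _) ((abs_sub _ _).trans (add_le_add (hB _) (abs_resample_le i hB ξ))) 2
    -- the mean minimises the mean-square deviation on the fibre
    have hmin : ∫ y, (f (update ξ i y) - ∫ z, f (update ξ i z) ∂π) ^ 2 ∂π ≤ ∫ y, (f (update ξ i y) - resample q i f ξ) ^ 2 ∂π := by
      set h : E i → ℝ := fun y => f (update ξ i y) with hh
      set a : ℝ := ∫ z, h z ∂π with ha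
      set m : ℝ := resample q i f ξ with hm
      have hhm : Measurable h := hfm.comp (measurable_update ξ)
      have hhb : ∀ y, |h y| ≤ B := fun y => hB _
      have hab : |a| ≤ B := abs_integral_le_of_abs_le π hhb
      have hi : Integrable h π := integrable_of_abs_le_const hhm.stronglyMeasurable hhb
      have hi1 : Integrable (fun s => (h s - a) ^ 2) π :=
        integrable_of_abs_le_const ((hhm.sub measurable_const).pow_const 2).stronglyMeasurable (R := (B + B) ^ 2) fun s => by
          rw [abs_pow]; exact pow_le_pow_left₀ (abs_nonneg _) ((abs_sub _ _).trans (add_le_add (hhb s) hab)) 2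
      have hi2 : Integrable (fun s => 2 * (a - m) * (h s - a)) π := (hi.sub (integrable_const a)).const_mul _
      have hi12 : Integrable (fun s => (h s - a) ^ 2 + 2 * (a - m) * (h s - a)) π := hi1.add hi2
      have hsplit : ∀ s, (h s - m) ^ 2 = ((h s - a) ^ 2 + 2 * (a - m) * (h s - a)) + (a - m) ^ 2 := fun s => by ring
      change ∫ y, (h y - a) ^ 2 ∂π ≤ ∫ y, (h y - m) ^ 2 ∂π
      simp_rw [hsplit]
      rw [integral_add hi12 (integrable_const _), integral_add hi1 hi2, integral_const_mul,
        integral_sub hi (integrable_const a), integral_const, integral_const]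
      simp only [smul_eq_mul, probReal_univ, one_mul]
      rw [← ha, sub_self, mul_zero, add_zero]
      nlinarith [sq_nonneg (a - m)]
    calc Real.exp (-δ) * ∫ y, (f (update ξ i y) - ∫ z, f (update ξ i z) ∂π) ^ 2 ∂π
        ≤ Real.exp (-δ) * ∫ y, (f (update ξ i y) - resample q i f ξ) ^ 2 ∂π :=
          mul_le_mul_of_nonneg_left hmin (Real.exp_pos _).le
      _ ≤ ∫ y, (f (update ξ i y) - resample q i f ξ) ^ 2 ∂(q i ξ) := hfloor ξ _ _ hgm (fun y => sq_nonneg _) hgb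

/-- **Resampling a site from the a-priori law costs at most `e^{−δ}` on the mean of a non-negative observable**, under the same density
floor. [folklore] -/
theorem exp_neg_mul_integral_resample_le_of_floor (hinv : ResamplingInvariant Q q) (i : ι) (π : Measure (E i)) [IsProbabilityMeasure π]
    {δ : ℝ}
    (hfloor : ∀ (ξ : (j : ι) → E j) (g : E i → ℝ) (B : ℝ), Measurable g → (∀ y, 0 ≤ g y) → (∀ y, |g y| ≤ B) →
      Real.exp (-δ) * ∫ y, g y ∂π ≤ ∫ y, g y ∂(q i ξ))
    {g : ((j : ι) → E j) → ℝ} {B : ℝ} (hgm : Measurable g) (hB : ∀ ξ, |g ξ| ≤ B) (hg0 : ∀ ξ, 0 ≤ g ξ) :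
    Real.exp (-δ) * ∫ ξ, (∫ y, g (update ξ i y) ∂π) ∂Q ≤ ∫ ξ, g ξ ∂Q := by
  rw [← hinv i g B hgm hB, ← integral_const_mul]
  refine integral_mono_of_nonneg (Filter.Eventually.of_forall fun ξ => ?_) ?_ (Filter.Eventually.of_forall fun ξ => ?_)
  · exact mul_nonneg (Real.exp_pos _).le (integral_nonneg fun y => hg0 _)
  · exact integrable_of_abs_le_const (measurable_resample i hgm).stronglyMeasurable (abs_resample_le (q := q) i hB)
  · exact hfloor ξ _ _ (hgm.comp (measurable_update ξ)) (fun y => hg0 _) fun y => hB _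

end Abstract

/-! ### Part B — the one-link kernels of the Wilson specification on `ℤ^d` -/

section Wilson

variable {d N : ℕ} {G : Type*} [Group G] [TopologicalSpace G] [IsTopologicalGroup G] [CompactSpace G]
  [MeasurableSpace G] [BorelSpace G] [SecondCountableTopology G] [T2Space G] (ρ : G →* Matrix (Fin N) (Fin N) ℂ)

/-- The one-link law `U ↦ siteLaw (ymSpecification ρ β) e U` is a measurable (kernel) map. [folklore] -/
theorem measurable_siteLaw_ymSpecification (hρ : Continuous ρ) (β : ℝ) (e : Literature.MathematicalPhysics.QuantumLattice.ZdEdge d) :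
    Measurable fun U : LGConfig d G => siteLaw (ymSpecification ρ β) e U :=
  (Measure.measurable_map _ (measurable_pi_apply e)).comp ((isSpecification_ymSpecification_of_t2Space ρ hρ β).measurable_fun {e})

omit [T2Space G] in
/-- **Finite range**: the one-link law at `e` does not read the link `e'` when `e' = e` or no plaquette contains both (`siteLaw_ymSpecification_congr`
over `linkPlaqNbr`). [folklore] -/
theorem siteLaw_ymSpecification_update_of_separated (hρ : Continuous ρ) (β : ℝ)
    {e e' : Literature.MathematicalPhysics.QuantumLattice.ZdEdge d}
    (h : e' = e ∨ ∀ p : ZdPlaquette d, e ∈ plaquetteEdges p → e' ∉ plaquetteEdges p) (U : LGConfig d G) (y : G) :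
    siteLaw (ymSpecification ρ β) e (update U e' y) = siteLaw (ymSpecification ρ β) e U := by
  classical
  refine siteLaw_ymSpecification_congr ρ hρ β e fun z hz => ?_
  have hze' : z ≠ e' := by
    intro hze'
    rw [hze'] at hz
    rcases h with h | h
    · rw [h] at hz
      exact not_mem_linkPlaqNbr e hz
    · obtain ⟨-, p, hep, hzp⟩ := mem_linkPlaqNbr_iff.1 hz
      exact h p hep hzp
  exact update_of_ne hze' y U

/-- **The DLR equation at one link as resampling invariance**: every DLR state of the Wilson specification is invariant under resampling any
link from its one-link law (`siteAvg_eq_integral_siteLaw` + `IsGibbsMeasure.integral_integral_eq`). [folklore] -/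
theorem resamplingInvariant_of_mem_ymGibbsMeasures (hρ : Continuous ρ) {β : ℝ} {μ : Measure (LGConfig d G)}
    (hμ : μ ∈ ymGibbsMeasures ρ β) :
    ResamplingInvariant μ (fun e : Literature.MathematicalPhysics.QuantumLattice.ZdEdge d =>
      (⟨fun U : LGConfig d G => siteLaw (ymSpecification ρ β) e U, measurable_siteLaw_ymSpecification ρ hρ β e⟩ :
        Kernel (LGConfig d G) G)) := by
  classical
  intro e F B hFm hFB
  have hγ := isSpecification_ymSpecification_of_t2Space (d := d) ρ hρ β
  haveI := hμ.isProbabilityMeasure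
  have hk : ∀ U : LGConfig d G,
      ((⟨fun U : LGConfig d G => siteLaw (ymSpecification ρ β) e U, measurable_siteLaw_ymSpecification ρ hρ β e⟩ :
        Kernel (LGConfig d G) G) U) = siteLaw (ymSpecification ρ β) e U := fun U => rfl
  have h1 : (fun U : LGConfig d G => ∫ y, F (update U e y)
      ∂((⟨fun U : LGConfig d G => siteLaw (ymSpecification ρ β) e U, measurable_siteLaw_ymSpecification ρ hρ β e⟩ :
        Kernel (LGConfig d G) G) U)) = fun U => ∫ σ, F σ ∂(ymSpecification ρ β {e} U) := by
    funext U
    rw [hk U, ← siteAvg_eq_integral_siteLaw hγ e hFm U]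
    rfl
  rw [h1]
  exact hμ.integral_integral_eq hγ {e} (integrable_of_abs_le' hFm hFB)

/-- The one-link kernels of the Wilson specification are Markov kernels. [folklore] -/
theorem isMarkovKernel_siteLaw_ymSpecification (hρ : Continuous ρ) (β : ℝ) (e : Literature.MathematicalPhysics.QuantumLattice.ZdEdge d) :
    IsMarkovKernel ((⟨fun U : LGConfig d G => siteLaw (ymSpecification ρ β) e U, measurable_siteLaw_ymSpecification ρ hρ β e⟩ :
      Kernel (LGConfig d G) G)) :=
  ⟨fun U => isProbabilityMeasure_siteLaw (isSpecification_ymSpecification_of_t2Space ρ hρ β) e U⟩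

omit [T2Space G] in
/-- **Density floor of the one-link law**: for unitary `ρ` and every boundary condition, the one-link law of the Wilson specification at `e`
dominates `e^{−4(d−1)N|β|}·Haar` on non-negative bounded measurable observables (the one-link energy `β Σ_{p∋e} Re tr(ρ(g)ρ(staple))` has
oscillation `≤ 2|β|·N·#{p ∋ e} ≤ 4(d−1)N|β|`). [folklore] -/
theorem exp_neg_mul_integral_haar_le_integral_siteLaw (hρ : Continuous ρ) (hρu : ∀ g, ρ g ∈ Matrix.unitaryGroup (Fin N) ℂ) (β : ℝ)
    (e : Literature.MathematicalPhysics.QuantumLattice.ZdEdge d) (U : LGConfig d G) {g : G → ℝ} {B : ℝ} (hgm : Measurable g)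
    (hg0 : ∀ y, 0 ≤ g y) (hB : ∀ y, |g y| ≤ B) :
    Real.exp (-(4 * (d - 1 : ℕ) * N * |β|)) * ∫ y, g y ∂haarProbability G ≤ ∫ y, g y ∂(siteLaw (ymSpecification ρ β) e U) := by
  classical
  rw [PlaquettePositivity.siteLaw_eq_tilted_sum ρ hρ hρu β e U]
  set R : G → ℝ := fun y => ∑ p ∈ plaquettesTouching {e}, (ρ y * ρ (staple p e U)).trace.re with hR
  have hRm : Measurable R := (PlaquettePositivity.continuous_sum_re_trace_staple ρ hρ e U).measurable
  have hRb : ∀ y, |R y| ≤ (plaquettesTouching {e}).card * N := PlaquettePositivity.abs_sum_re_trace_staple_le ρ hρu e U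
  have hcard : ((plaquettesTouching {e}).card : ℝ) ≤ ((2 * (d - 1) : ℕ) : ℝ) := by
    exact_mod_cast card_plaquettesTouching_singleton_le e
  have hM : ∀ y, |β * R y| ≤ 2 * (d - 1 : ℕ) * N * |β| := fun y => by
    rw [abs_mul]
    have h1 : |R y| ≤ 2 * (d - 1 : ℕ) * N := (hRb y).trans (by
      have := mul_le_mul_of_nonneg_right hcard (Nat.cast_nonneg N); push_cast at this ⊢; linarith)
    calc |β| * |R y| ≤ |β| * (2 * (d - 1 : ℕ) * N) := mul_le_mul_of_nonneg_left h1 (abs_nonneg β)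
      _ = 2 * (d - 1 : ℕ) * N * |β| := by ring
  have hB0 : ∀ y, g y ≤ B := fun y => (le_abs_self _).trans (hB y)
  have h := PlaquettePositivity.exp_neg_mul_integral_le_integral_tilted (ν := haarProbability G) hgm hg0 hB0
    (φ := fun y => β * R y) (hRm.const_mul β) (a := -(2 * (d - 1 : ℕ) * N * |β|)) (D := 4 * (d - 1 : ℕ) * N * |β|)
    (Filter.Eventually.of_forall fun y => by
      have h1 := abs_le.1 (hM y)
      constructor <;> linarith [h1.1, h1.2])
  simpa [hR] using h

end Wilson

end EnergyVariance

end Summit.Ventures.YMGap.RobustBall
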